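import Mathlib
import HarnessLib
import Summits.NavierStokesRegularity.NavierStokesRegularity.Theorems.TypeIQuarterGateScarEnvelopeTypeIForcedTsaiAlgDecay
import Summits.NavierStokesRegularity.NavierStokesRegularity.Theorems.TypeIQuarterGateScarEnvelopeTypeIForcedTsaiAlgWitnessLB16
import Summits.NavierStokesRegularity.NavierStokesRegularity.Theorems.TypeIQuarterGateScarEnvelopeTypeIForcedTsaiAlgWitnessLB8
import Summits.NavierStokesRegularity.NavierStokesRegularity.Theorems.TypeIQuarterGateScarEnvelopeTypeIForcedTsaiAlgWitnessGX16
import Summits.NavierStokesRegularity.NavierStokesRegularity.Theorems.TypeIQuarterGateScarEnvelopeTypeIForcedTsaiAlgWitnessGX8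

/-!
# ARM B lane E-exact — REPAIRED-CURRENCY ROWS for the ns-wall-extremal LANEX-ALG-LB vectors (eng-3 g2 j319388 / j320791): Type-I decay class

Rows of this seat RE-STATED IN THE REPAIRED CURRENCY `ForcedTsaiModulusTypeILE C₀ M δ` (`…ForcedTsaiTypeIDefs`; ns-wall-extremal
typed-currency audit 2026-08-29: the decay-free `ForcedTsaiModulusLE` is level-blind).  For each landed witness the kernel's
symbolic TYPE-I DECAY CERTIFICATE (`AlgRow.decayCheck`, `…ForcedTsaiAlgDecay`) supplies an explicit constant `C₀` with
`(1+|y|)‖U(y)‖ ≤ C₀`; the level and residual numbers are those of the landed `checkG`/`checkX` theorems (reused, not replayed).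
The printed `C₀` is the CRUDE bound `(1+τ)Σ|c|τ^{|a|+2k}` (it ignores all cancellations between monomials; the floating-point
`sup(1+|y|)|U|` of these witnesses is of order 0.1–10); a tighter certified `C₀` needs an interval evaluation — follow-up.
`ForcedTsaiModulusTypeILE 263800 16 292.617` (δ/M = 18.2886); `ForcedTsaiModulusTypeILE 234912 8 135.895` (δ/M = 16.9869); `ForcedTsaiModulusTypeILE 258322 16 286.152` (δ/M = 17.8845); `ForcedTsaiModulusTypeILE 228612 8 131.839` (δ/M = 16.4799).
UPPER-bound / existence statements about explicit near-profiles in the Type-I decay class; no infimum is claimed positive;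
excludes nothing; nothing about NS regularity; 23843 / H3 OPEN.
-/

set_option linter.dupNamespace false

namespace Summit.NavierStokesRegularity.NavierStokesRegularity.Cruxes.ScarEnvelopeTypeI.ForcedTsai

/-- Type-I decay certificate of the witness of `algRowGLB16r0`: every monomial of `u = curl Ψ` has `h ≥ |a|+2k+1` and the
symbolic constant `(1+τ)Σ|c|τ^{|a|+2k}` is `≤ 263800` (kernel replay; a CRUDE but valid bound — the float `sup (1+|y|)|U|` is far smaller). -/
theorem algRowGLB16r0_decay : algRowGLB16r0.toRow.decayCheck 263800 = true := by
  native_decide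

/-- **Repaired-currency row** `ForcedTsaiModulusTypeILE 263800 16 (292617 / 1000)`: the named witness field is smooth, divergence-free,
TYPE-I DECAYING with `(1+|y|)‖U(y)‖ ≤ 263800`, has level `≥ 16` on `B₁₀` and weighted vorticity residual `≤ 292.617`
(δ/M = 18.2886).  An UPPER-bound / existence statement in the decay class; excludes nothing. -/
theorem forcedTsaiModulusTypeILE_LB_16 : ForcedTsaiModulusTypeILE (263800 : ℝ) (16 : ℝ) (292617 / 1000 : ℝ) := by
  have h := AlgRowG.typeI_sound algRowGLB16r0 263800 algRowGLB16r0_checkG algRowGLB16r0_decay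
  have hM : algRowGLB16r0.M = 16 := rfl
  have hδ : algRowGLB16r0.δ = (292617 / 1000) := rfl
  rw [hM, hδ] at h
  push_cast at h
  exact h

/-- Type-I decay certificate of the witness of `algRowGLB8r0`: every monomial of `u = curl Ψ` has `h ≥ |a|+2k+1` and the
symbolic constant `(1+τ)Σ|c|τ^{|a|+2k}` is `≤ 234912` (kernel replay; a CRUDE but valid bound — the float `sup (1+|y|)|U|` is far smaller). -/
theorem algRowGLB8r0_decay : algRowGLB8r0.toRow.decayCheck 234912 = true := by
  native_decide

/-- **Repaired-currency row** `ForcedTsaiModulusTypeILE 234912 8 (27179 / 200)`: the named witness field is smooth, divergence-free,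
TYPE-I DECAYING with `(1+|y|)‖U(y)‖ ≤ 234912`, has level `≥ 8` on `B₁₀` and weighted vorticity residual `≤ 135.895`
(δ/M = 16.9869).  An UPPER-bound / existence statement in the decay class; excludes nothing. -/
theorem forcedTsaiModulusTypeILE_LB_8 : ForcedTsaiModulusTypeILE (234912 : ℝ) (8 : ℝ) (27179 / 200 : ℝ) := by
  have h := AlgRowG.typeI_sound algRowGLB8r0 234912 algRowGLB8r0_checkG algRowGLB8r0_decay
  have hM : algRowGLB8r0.M = 8 := rfl
  have hδ : algRowGLB8r0.δ = (27179 / 200) := rfl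
  rw [hM, hδ] at h
  push_cast at h
  exact h

/-- Type-I decay certificate of the witness of `algRowXGX16r0`: every monomial of `u = curl Ψ` has `h ≥ |a|+2k+1` and the
symbolic constant `(1+τ)Σ|c|τ^{|a|+2k}` is `≤ 258322` (kernel replay; a CRUDE but valid bound — the float `sup (1+|y|)|U|` is far smaller). -/
theorem algRowXGX16r0_decay : algRowXGX16r0.toRowG.toRow.decayCheck 258322 = true := by
  native_decide

/-- **Repaired-currency row** `ForcedTsaiModulusTypeILE 258322 16 (35769 / 125)`: the named witness field is smooth, divergence-free,
TYPE-I DECAYING with `(1+|y|)‖U(y)‖ ≤ 258322`, has level `≥ 16` on `B₁₀` and weighted vorticity residual `≤ 286.152`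
(δ/M = 17.8845).  An UPPER-bound / existence statement in the decay class; excludes nothing. -/
theorem forcedTsaiModulusTypeILE_GX_16 : ForcedTsaiModulusTypeILE (258322 : ℝ) (16 : ℝ) (35769 / 125 : ℝ) := by
  have h := AlgRowX.typeI_sound algRowXGX16r0 258322 algRowXGX16r0_checkX algRowXGX16r0_decay
  have hM : algRowXGX16r0.M = 16 := rfl
  have hδ : algRowXGX16r0.δ = (35769 / 125) := rfl
  rw [hM, hδ] at h
  push_cast at h
  exact h

/-- Type-I decay certificate of the witness of `algRowXGX8r0`: every monomial of `u = curl Ψ` has `h ≥ |a|+2k+1` and the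
symbolic constant `(1+τ)Σ|c|τ^{|a|+2k}` is `≤ 228612` (kernel replay; a CRUDE but valid bound — the float `sup (1+|y|)|U|` is far smaller). -/
theorem algRowXGX8r0_decay : algRowXGX8r0.toRowG.toRow.decayCheck 228612 = true := by
  native_decide

/-- **Repaired-currency row** `ForcedTsaiModulusTypeILE 228612 8 (131839 / 1000)`: the named witness field is smooth, divergence-free,
TYPE-I DECAYING with `(1+|y|)‖U(y)‖ ≤ 228612`, has level `≥ 8` on `B₁₀` and weighted vorticity residual `≤ 131.839`
(δ/M = 16.4799).  An UPPER-bound / existence statement in the decay class; excludes nothing. -/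
theorem forcedTsaiModulusTypeILE_GX_8 : ForcedTsaiModulusTypeILE (228612 : ℝ) (8 : ℝ) (131839 / 1000 : ℝ) := by
  have h := AlgRowX.typeI_sound algRowXGX8r0 228612 algRowXGX8r0_checkX algRowXGX8r0_decay
  have hM : algRowXGX8r0.M = 8 := rfl
  have hδ : algRowXGX8r0.δ = (131839 / 1000) := rfl
  rw [hM, hδ] at h
  push_cast at h
  exact h

end Summit.NavierStokesRegularity.NavierStokesRegularity.Cruxes.ScarEnvelopeTypeI.ForcedTsai
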